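import Literature.AlgebraicGeometry.HodgeTheory.PullbackVanishingOnDominatedVariety
import Literature.AlgebraicGeometry.HodgeTheory.SubschemeStrataClassVanishing
import Literature.AlgebraicGeometry.Motives.GoodReductionSpecialFibreProofs
import Literature.AlgebraicTopology.SingularHomology.CohomologyDisjointOpenCover
import HarnessLib

/-!
# A class dying on `Y_j → X` dies on every smooth closed subscheme of `X'` mapping into `⋃ g_j(Y_j)`

Topic: `Literature/AlgebraicGeometry/HodgeTheory`. A step of the direct proof of P. Deligne,
*Théorie de Hodge III* (1974), Prop. 8.2.7, removing the irreducibility hypothesis of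
`complexBetti_map_eq_zero_of_range_subset_iUnion` (`PullbackVanishingOnDominatedVariety.lean`):
for `σ : X' → X` a morphism of smooth projective complex varieties, `E ↪ X'` a closed subscheme
smooth over `ℂ` (of some relative dimension; possibly disconnected) with `σ(E) ⊆ ⋃_j g_j(Y_j)`,
and `x'` killed by every `g_j^*`, the class `(E ↪ X' → X)^* x'` vanishes
(`complexBetti_map_eq_zero_of_smooth_closedSubscheme`).

Proof: the irreducible components of the smooth `E` are open (the local rings are domains;
Görtz–Wedhorn I, Exercise 3.16), pairwise disjoint, each a smooth projective (geometrically
irreducible) variety; their complex points form a clopen partition of `E(ℂ)`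
(`AlgPoints.isOpenEmbedding_map_holds`), over which singular cohomology is a product (Hatcher
§3.1 p. 202: `eq_zero_of_forall_map_subsetIncl_eq_zero`); on each component the irreducible case
applies. Everything is proved; no named facts (D-0026).

## References

* P. Deligne, *Théorie de Hodge III*, Publ. Math. IHÉS 44 (1974), Prop. 8.2.7.
* U. Görtz, T. Wedhorn, *Algebraic Geometry I* (2020), Exercise 3.16.
* A. Hatcher, *Algebraic Topology* (2002), §3.1 p. 202.
-/

noncomputable section

set_option backward.isDefEq.respectTransparency false

open CategoryTheory CategoryTheory.Limits AlgebraicGeometry TopologicalSpace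
open Literature.AlgebraicTopology.SingularHomology Literature.AlgebraicGeometry.Resolution

namespace Literature.AlgebraicGeometry.HodgeTheory

open Literature.AlgebraicGeometry.Motives

/-! ### Irreducible components of a locally Noetherian scheme with integral local rings -/

section Components

variable {W : Scheme} [IsLocallyNoetherian W]

/-- On a locally Noetherian scheme whose local rings are domains, the irreducible components are
open (Görtz–Wedhorn I, Exercise 3.16; the argument of the tree's
`irreducibleSpace_of_isDomain_stalk`). [cite: GortzWedhorn2020, Exercise 3.16 (p. 117)] -/
theorem isOpen_of_mem_irreducibleComponents_of_isDomain_stalk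
    (h : ∀ x : W, IsDomain (W.presheaf.stalk x)) {Z : Set W} (hZ : Z ∈ irreducibleComponents W) :
    IsOpen Z := by
  rw [isOpen_iff_forall_mem_open]
  intro z hz
  haveI := h z
  obtain ⟨V, hVo, hzV, hVirr⟩ := exists_isOpen_isIrreducible_of_isDomain_stalk W z
  refine ⟨V, ?_, hVo, hzV⟩
  have h1 : Z ⊆ closure V :=
    (subset_closure_inter_of_isPreirreducible_of_isOpen hZ.1.2 hVo ⟨z, hz, hzV⟩).trans
      (closure_mono Set.inter_subset_right)
  have h2 : closure V = Z := Set.Subset.antisymm (hZ.2 hVirr.closure h1) h1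
  exact h2 ▸ subset_closure

omit [IsLocallyNoetherian W] in
/-- Distinct irreducible components which are open are disjoint. [folklore] -/
theorem disjoint_of_mem_irreducibleComponents_of_isOpen {Z₁ Z₂ : Set W}
    (h₁ : Z₁ ∈ irreducibleComponents W) (h₂ : Z₂ ∈ irreducibleComponents W) (ho₂ : IsOpen Z₂)
    (hne : Z₁ ≠ Z₂) : Disjoint Z₁ Z₂ := by
  rw [Set.disjoint_iff_inter_eq_empty]
  by_contra hI
  obtain ⟨x, hx⟩ := Set.nonempty_iff_ne_empty.mpr hI
  have hsub : Z₁ ⊆ Z₂ := by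
    have h1 : Z₁ ⊆ closure (Z₁ ∩ Z₂) :=
      subset_closure_inter_of_isPreirreducible_of_isOpen h₁.1.2 ho₂ ⟨x, hx⟩
    exact h1.trans ((closure_mono Set.inter_subset_right).trans
      (isClosed_of_mem_irreducibleComponents Z₂ h₂).closure_subset)
  exact hne (Set.Subset.antisymm hsub (h₁.2 h₂.1 hsub))

end Components

/-! ### The components of a smooth closed subscheme of a projective variety -/

section Main

/-- **A class killed by every `g_j^*` dies on every smooth closed subscheme of `X'` mapping into
`⋃ g_j(Y_j)`.** See the module docstring. [cite: DeligneHodgeIII1974, Prop. 8.2.7]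
[cite: GortzWedhorn2020, Exercise 3.16 (p. 117)] [cite: HatcherAT2002, §3.1 p. 202] -/
theorem complexBetti_map_eq_zero_of_smooth_closedSubscheme {n nX : ℕ} {X' X : SchemeOver ℂ}
    (hX' : IsSmoothProjective n X') (hX : IsSmoothProjective nX X) (σ : X' ⟶ X)
    {E : SchemeOver ℂ} (e : E ⟶ X') [IsClosedImmersion e.left] {dE : ℕ}
    [SmoothOfRelativeDimension dE E.hom]
    {ι : Type} [Finite ι] {m : ι → ℕ} {Y : ι → SchemeOver ℂ}
    (hY : ∀ j, IsSmoothProjective (m j) (Y j)) (g : ∀ j, Y j ⟶ X)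
    (hrange : Set.range (e ≫ σ).left ⊆ ⋃ j, Set.range (g j).left)
    {q : ℕ} (x' : complexBetti X q) (hx' : ∀ j, complexBetti.map (g j) q x' = 0) :
    complexBetti.map (e ≫ σ) q x' = 0 := by
  classical
  -- instances on `E`
  haveI : IsProper X'.hom := hX'.isProjectiveOver.isProper
  haveI : IsProper E.hom := by rw [← Over.w e]; infer_instance
  haveI : IsLocallyNoetherian E.left := LocallyOfFiniteType.isLocallyNoetherian E.hom
  have hdom : ∀ x : E.left, IsDomain (E.left.presheaf.stalk x) := fun x ↦
    isDomain_stalk_of_smoothOfRelativeDimension E.hom dE x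
  haveI : IsReduced E.left := isReduced_of_smoothOfRelativeDimension E.hom dE
  -- the components, as open subschemes
  set C := irreducibleComponents E.left with hC
  have hopen : ∀ Z : C, IsOpen (Z.1 : Set E.left) := fun Z ↦
    isOpen_of_mem_irreducibleComponents_of_isDomain_stalk hdom Z.2
  let U : C → E.left.Opens := fun Z ↦ ⟨Z.1, hopen Z⟩
  let EZ : C → SchemeOver ℂ := fun Z ↦ Over.mk ((U Z).ι ≫ E.hom)
  let eZ : ∀ Z : C, EZ Z ⟶ E := fun Z ↦ Over.homMk (U Z).ι rfl
  haveI heZopen : ∀ Z : C, IsOpenImmersion (eZ Z).left := fun Z ↦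
    inferInstanceAs (IsOpenImmersion (U Z).ι)
  -- each component is a smooth projective (geometrically irreducible) variety of dimension `dE`
  have hEZ : ∀ Z : C, IsSmoothProjective dE (EZ Z) := by
    intro Z
    have hsm : SmoothOfRelativeDimension dE (EZ Z).hom :=
      IsZariskiLocalAtSource.comp (P := @SmoothOfRelativeDimension dE) ‹_› (U Z).ι
    -- closed immersion `E_Z ↪ E ↪ X'`
    have hrangeZ : Set.range (U Z).ι = (Z.1 : Set E.left) := Scheme.Opens.range_ι _
    haveI : IsClosedImmersion (eZ Z).left := by
      refine IsClosedImmersion.of_isPreimmersion _ ?_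
      change IsClosed (Set.range (U Z).ι)
      rw [hrangeZ]
      exact isClosed_of_mem_irreducibleComponents _ Z.2
    haveI : IsClosedImmersion (eZ Z ≫ e).left := by
      rw [Over.comp_left]; infer_instance
    have hproj : IsProjectiveOver (EZ Z) :=
      isProjectiveOver_of_isClosedImmersion_left (eZ Z ≫ e) hX'.isProjectiveOver
    -- integral: irreducible (a component) and reduced (smooth)
    haveI : IrreducibleSpace (EZ Z).left := by
      change IrreducibleSpace (U Z)
      have hirr : IsIrreducible ((U Z : E.left.Opens) : Set E.left) := Z.2.1
      exact Subtype.irreducibleSpace hirr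
    haveI : IsReduced (EZ Z).left := isReduced_of_smoothOfRelativeDimension (EZ Z).hom dE
    haveI : IsIntegral (EZ Z).left := isIntegral_of_irreducibleSpace_of_isReduced _
    haveI := geometricallyIntegral_of_isAlgClosed (EZ Z).hom
    exact ⟨hsm, hproj, inferInstance⟩
  -- on each component the class dies
  set u : complexBetti E q := complexBetti.map (e ≫ σ) q x' with hu
  have huZ : ∀ Z : C, complexBetti.map (eZ Z) q u = 0 := by
    intro Z
    rw [hu, ← ModuleCat.comp_apply, ← complexBetti.map_comp]
    refine complexBetti_map_eq_zero_of_range_subset_iUnion (hEZ Z) hX (eZ Z ≫ e ≫ σ) hY g ?_ x' hx'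
    rintro _ ⟨t, rfl⟩
    exact hrange ⟨(eZ Z).left t, by simp [Over.comp_left]⟩
  -- the complex points of the components form a clopen partition of `E(ℂ)`
  let A : C → Set (ComplexPoints E) := fun Z ↦ Set.range (AlgPoints.map (L := ℂ) (eZ Z))
  have hArange : ∀ Z : C, A Z = {P : ComplexPoints E | P.pt ∈ (Z.1 : Set E.left)} := by
    intro Z
    change Set.range (AlgPoints.map (L := ℂ) (eZ Z)) = _
    rw [AlgPoints.range_map_of_isOpenImmersion_holds (L := ℂ) (eZ Z)]
    ext P
    change P.pt ∈ (((U Z).ι.opensRange : E.left.Opens) : Set E.left) ↔ P.pt ∈ (Z.1 : Set E.left)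
    rw [Scheme.Opens.opensRange_ι]
    rfl
  have hA : IsClopenPartition A := by
    refine IsClopenPartition.of_pairwise_disjoint (fun Z ↦ ?_) (fun Z₁ Z₂ hne ↦ ?_) ?_
    · exact (AlgPoints.isOpenEmbedding_map_holds (L := ℂ) (eZ Z)).isOpen_range
    · change Disjoint (A Z₁) (A Z₂)
      rw [hArange, hArange, Set.disjoint_left]
      intro P h₁ h₂
      have hd := disjoint_of_mem_irreducibleComponents_of_isOpen Z₁.2 Z₂.2 (hopen Z₂)
        (fun h ↦ hne (Subtype.ext h))
      exact Set.disjoint_left.mp hd h₁ h₂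
    · refine Set.eq_univ_of_forall fun P ↦ Set.mem_iUnion.mpr ?_
      refine ⟨⟨irreducibleComponent P.pt, irreducibleComponent_mem_irreducibleComponents _⟩, ?_⟩
      rw [hArange]
      exact mem_irreducibleComponent
  -- conclude
  refine singularCohomology.eq_zero_of_forall_map_subsetIncl_eq_zero (R := ℂ) (M := ℂ) hA fun Z ↦ ?_
  have hemb := (AlgPoints.isOpenEmbedding_map_holds (L := ℂ) (eZ Z)).isEmbedding
  refine singularCohomology_map_eq_zero_of_comp_homeomorph hemb.toHomeomorph (subsetIncl (A Z)) u ?_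
  have hcomp : (subsetIncl (A Z)).comp (hemb.toHomeomorph : C(ComplexPoints (EZ Z), A Z)) =
      AlgPoints.mapContinuous (L := ℂ) (eZ Z) :=
    ContinuousMap.ext fun _ ↦ rfl
  rw [hcomp]
  exact huZ Z

end Main

end Literature.AlgebraicGeometry.HodgeTheory
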